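import Summits.ABC.ABC.Theorems.IUTThetaPilotABCOfCor312
import Summits.ABC.ABC.Theorems.IUTThetaPilotThetaPartIIULineCapstone
import Summits.ABC.ABC.Theorems.IUTThetaPilotThetaPartIIDegLe
import HarnessLib

/-!
# Branch C, layer certificate of the S layer (`LayerSOfS`, plan/C/ABC-OF-S-SPEC.md §3; C lead ruling C-R7):
# `ABC` from [IUTchIII] Cor. 3.12 at the genuine Θ-data of the `λ`-line — and nothing else

LayerS: CONE 1 (= (iii-P), [IUTchIII] Cor 3.12 read PER IMAGE at the Θ-volume datum, Step (x) p.181 — the (P) reading,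
STRONGER than the verbatim hull-of-union number on the Θ-side; status disputed) · S 0 · PIN 0 · FACT 0 · READ 0.

What this file certifies (abc-iut cell, branch C «conditional verification»; written by the S-layer seat abc-iut-S-d1 on the
C lead's ruling C-R7): what the S layer ([IUTchIV] §1–§2 and [GenEll]) contributes DOWNSTREAM of [IUTchIII] Cor. 3.12, as ONE
by-name conjunction over the S-lane capstones of the tree. It is NOT a certificate «`ABC` ⇐ S» for
`S = Cor312.PilotKummerIndRelated` (that is the apex `Conditional/AbcOfS.lean`): every hypothesis below is the Corollary
itself, at the genuine Θ-volume data of the `λ`-line (abc-iut-S2's `Cor22.ThetaVolumeDatumAt`, model reading v3),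
∀-quantified over the binders of `Cor22.Thm110Legendre` (`P ∈ U_P` minimally presented, `l` prime `≥ 5`, `AdmitsCore`,
(P2), (P5), (P6)) exactly as the registered children of crux `ThetaPartII` (stmt-ABC-19678, route `IUTThetaPilot`) are.
The three conjuncts of `layerS_of_S` are, BY NAME (the gate's dedup rule: each is an already-landed theorem, so the
certificate packages them and restates nothing):

1. the display-P line — `Summit.ABC.ABC.Theorems.ABC_of_cor312PerImage` (abc-iut-S2): `ABC` from
   `Cor22.Cor312PerImageAtDatum P l` (child (iii-P): "`−|log(q)| ≤ −|log(Θ)|`" with the Θ-side read PER IMAGE,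
   [IUTchIII] Cor. 3.12 proof Step (x), kurims p. 181 — a claim STRONGER than the statement's hull-of-union number,
   p. 174) at every admissible `(P, l)` and NOTHING ELSE — the per-image hull-volume estimate (ii′-P)
   (`ThetaPartII.stub_hullVolumePerImage`, abc-iut-c312-d1 over abc-iut-S3/S7/S1/S-d1/S2/L5-t15), the existence of Θ-data
   (i) (`ThetaPartII.stub_thetaData`, abc-iut-L5-t7), [IUTchIV] Thm. 1.10 Steps (viii)–(x) / Cor. 2.2 / Cor. 2.3
   (abc-iut-S3/S-d2/c312-8, `Cor22.fullGaloisImage_holds`, `closes`, `JInvWlog_proof`) and [GenEll] Thm. 2.1 at `Σ = {2}`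
   (`genEllTwo_holds`, abc-iut-S6) being theorems of the tree. Scoreboard CONE 1 · S 0 · PIN 0 · FACT 0 · READ 0.
2. the union line (U), print's number at the statement — `Summit.ABC.ABC.Theorems.ThetaPartII.ABC_of_cor312_of_hullRegime`
   (abc-iut-c312-8): `ABC` from `Cor22.Cor312AtDatum P l` (child (iii): Cor. 3.12 AS STATED, p. 174) TOGETHER WITH the
   hull-volume estimate with `B_III(P,l)` OFF the slot-constant regime (the open piece `stub_hullRegime` of the RESHAPE-2
   skeleton = VERDICT RISK ¶7: [IUTchIV] Thm. 1.10 Step (v), p. 28, at collections mixing places of `F_mod` of different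
   `q`-order; of Szpiro strength in-cell, abc-iut-S8 `PointDict.slotResidue_le_of_hullVolumeAtDatum`); on the slot-constant
   regime the estimate is discharged inside (`Cor22.ThetaVolumeDatumAt.towerFacts` abc-iut-S-d1, `ThetaPartII.stub_R4` /
   `….R4_towerFact` abc-iut-S1, abc-iut-S3's pinned junction). Scoreboard CONE 1 · RISK 1 · S 0 · PIN 0 · FACT 0 · READ 0.
3. the degree-one rung, where (U) = (P) and the volume side is UNCONDITIONAL —
   `Summit.ABC.ABC.Theorems.ThetaPartIIDisplay.vojtaIneq_two_degOne_of_cor312` (abc-iut-S2): Cor. 3.12 AS STATED at the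
   Θ-data of the RATIONAL points (`P.degree ≤ 1`, so `d_mod = 1`, no slot residue) implies Vojta with the printed `(1+ε)` on
   the rational points of every compactly bounded `K_V` whose support contains `2`. Scoreboard CONE 1 (restricted to
   degree 1) · S 0 · PIN 0 · FACT 0 · READ 0; conclusion = Vojta at `d = 1` on `K_V`, not `ABC` ([GenEll] Thm. 2.1's
   reduction passes through points of higher degree).

All three say «the conclusion follows from the listed hypotheses as typed», nothing more. HONEST FRAMING: nothing here
asserts [IUTchIII] Cor. 3.12 (in either reading), [IUTchIV] Thm. 1.10, or abc; no side is taken in the dispute, on (U) vs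
(P), or on any author; a binder is an assumption label, not an endorsement; typed ≠ proved.
[cite: Mochizuki2012, IUTchIV Cor. 2.2 (ii) pp.41–48] [cite: Mochizuki2012, IUTchIII Cor. 3.12 p.174]
[claim: Mochizuki2012, status: disputed] for every IUT quotation.
-/

noncomputable section

namespace Summit.ABC.IUTFork.Conditional

open Literature.NumberTheory.DiophantineGeometry.GenEll Literature.IUT.LogVolume
open Literature.IUT.HodgeTheaters NumberField IsDedekindDomain Literature.NumberTheory.NumberFields

/-- **LayerS — the S-layer certificate of branch C** (plan/C/ABC-OF-S-SPEC.md §3, C-R7): the conjunction, BY NAME, of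
(1) the display-P line `ABC ⇐ Cor22.Cor312PerImageAtDatum` at every admissible `(P, l)` (scoreboard CONE 1 · S 0 · PIN 0 ·
FACT 0 · READ 0; [IUTchIII] Cor. 3.12 read PER IMAGE, Step (x) p. 181 — STRONGER than the verbatim hull-of-union number;
DISPUTED, never asserted), (2) the union line `ABC ⇐ Cor22.Cor312AtDatum` (Cor. 3.12 AS STATED, p. 174) `+` the hull
estimate with `B_III` off the slot-constant regime (VERDICT RISK ¶7) (scoreboard CONE 1 · RISK 1), and (3) the degree-one
rung `Vojta(d = 1, K_V ∋ 2) ⇐ Cor22.Cor312AtDatum` on the rational points (volume side unconditional). Every other link of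
[IUTchIII] Cor. 3.12 ⇒ [IUTchIV] Thm. 1.10 ⇒ Cor. 2.2 ⇒ Cor. 2.3 ⇒ [GenEll] Thm. 2.1 ⇒ `ABC` is a theorem of the tree
(`ABC_of_cor312PerImage`, `ThetaPartII.ABC_of_cor312_of_hullRegime`, `ThetaPartIIDisplay.vojtaIneq_two_degOne_of_cor312`
and everything beneath them). CONDITIONAL; closes no item; certifies the S layer DOWNSTREAM of the Corollary, not «⇐ S».
[cite: Mochizuki2012, IUTchIV Cor. 2.2 (ii) pp.41–48] [claim: Mochizuki2012, status: disputed] -/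
theorem layerS_of_S :
    ((∀ P : NFPoint, P ∈ UP → ∀ l : ℕ, l.Prime → 5 ≤ l →
        Cor22.AdmitsCore P → Cor22.CondP2 P l → Cor22.CondP5 P l → Cor22.CondP6 P l →
          Cor22.Cor312PerImageAtDatum P l) → _root_.ABC) ∧
    ((∀ P : NFPoint, P ∈ UP → ∀ l : ℕ, l.Prime → 5 ≤ l →
        Cor22.AdmitsCore P → Cor22.CondP2 P l → Cor22.CondP5 P l → Cor22.CondP6 P l →
          Cor22.Cor312AtDatum P l) →
      (∀ P : NFPoint, P ∈ UP → ∀ l : ℕ, l.Prime → 5 ≤ l →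
        Cor22.AdmitsCore P → Cor22.CondP2 P l → Cor22.CondP5 P l → Cor22.CondP6 P l →
        ∀ T : Cor22.ThetaVolumeDatumAt P l,
          (letI := T.instFieldF; letI := T.instNumberFieldF; letI := T.instAlgebraF; letI := T.instFieldK
           letI := T.instNumberFieldK; letI := T.instAlgebraK; letI := T.instFieldFbar; letI := T.instAlgebraFbar
           letI := T.instAlgebraKFbar; letI := T.instIsElliptic
           ¬ (∀ p ∈ T.I.supportPrimes, ∀ v w : placesOver (fieldOfModuli T.E) p,
              (Summit.ABC.IUTFork.DHData.ofInput T.I).logQloc p v =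
                (Summit.ABC.IUTFork.DHData.ofInput T.I).logQloc p w)) →
          T.HullEstimateOf
            (((l : ℝ) + 1) / 4 *
              ((1 + 12 * (Cor22.dmod P : ℝ) / l) * (P.logDiff + Cor22.logCondAvoid P {2, l})
                + 2 * Real.log l + 52
                + 20 / 3 * Real.log (((2 ^ 12 * 3 ^ 3 * 5 * Cor22.dmod P : ℕ) : ℝ) * (l : ℝ))
                  * (Nat.primeCounting (2 ^ 12 * 3 ^ 3 * 5 * Cor22.dmod P * l) : ℝ)))) →
      _root_.ABC) ∧
    ((∀ P : NFPoint, P ∈ UP → P.degree ≤ 1 → ∀ l : ℕ, l.Prime → 5 ≤ l →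
        Cor22.AdmitsCore P → Cor22.CondP2 P l → Cor22.CondP5 P l → Cor22.CondP6 P l →
          Cor22.Cor312AtDatum P l) →
      ∀ ε : ℝ, 0 < ε → ∀ D : CBData, D.SupportContains {2} → VojtaIneq D.toSet 1 ε) :=
  ⟨Summit.ABC.ABC.Theorems.ABC_of_cor312PerImage,
   Summit.ABC.ABC.Theorems.ThetaPartII.ABC_of_cor312_of_hullRegime,
   fun h312 _ hε D hD => Summit.ABC.ABC.Theorems.ThetaPartIIDisplay.vojtaIneq_two_degOne_of_cor312 h312 hε D hD⟩

end Summit.ABC.IUTFork.Conditional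

end
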